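import Literature.AlgebraicGeometry.Resolution.AlterationsPurelyInseparable
import Literature.AlgebraicGeometry.Resolution.AlterationsResolution
import Mathlib.AlgebraicGeometry.Morphisms.Proper
import Mathlib.AlgebraicGeometry.Morphisms.Finite
import Mathlib.AlgebraicGeometry.Morphisms.UniversallyInjective
import HarnessLib

/-!
# `Pialt` (crux stmt-ResolutionOfSingularities-0555), line `IndeterminacySplit`, birational transfer

Stub `stub_piRegModel_of_birational` of the skeleton `indeterminacy-split`
(`Cruxes/Pialt/Lines/IndeterminacySplit.lean`; helper file,
`--supports stmt-ResolutionOfSingularities-0555`; does not close the item).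

**Statement.** Let `X` and `H` be proper integral schemes over a field `k`, birational over `k`
through a `k`-isomorphism `e : W ≅ U` between opens `W ⊆ H` and `U ⊆ X` with `U` non-empty
(`W.ι ≫ fH = e ≫ U.ι ≫ f`). If `H` carries the crux datum — a proper surjective `g : H' → H`
with `H'` integral and regular, finite and universally injective over a dense open `U_H ⊆ H` —
then `X` has a regular proper purely inseparable MODEL: a proper integral regular `Y / k` with a
finite, universally injective, surjective `k`-morphism from an open of `Y` onto a non-empty open
of `X`.

**Proof.** `Y := H'` over `k` via `g ≫ fH`. With `W₀ := W ⊓ U_H` (non-empty: `W` is non-empty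
as the source of an isomorphism onto the non-empty `U`, and `U_H` is a dense open), the composite
`j := (W₀ ↪ W) ≫ e ≫ U.ι : W₀ → X` is an open immersion; put `U_X := j.opensRange`,
`V := g ⁻¹ᵁ W₀` and `ψ := (g ∣_ W₀) ≫ (W₀ ≅ U_X)`. Then `g ∣_ W₀` is finite and universally
injective (restriction of `g ∣_ U_H` to the smaller open `W₀ ≤ U_H`, Stacks 01S4 / 01WM) and
surjective (surjectivity is Zariski-local on the target), hence so is `ψ`; and
`V.ι ≫ g ≫ fH = (g ∣_ W₀) ≫ W₀.ι ≫ fH = (g ∣_ W₀) ≫ (W₀ ↪ W) ≫ e ≫ U.ι ≫ f = ψ ≫ U_X.ι ≫ f`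
by `morphismRestrict_ι`, `hcomm` and `isoOpensRange_hom_ι`. Elementary scheme theory; no named
facts are used.
-/

set_option linter.dupNamespace false -- mandated namespace of this single-conjunct summit

noncomputable section

open CategoryTheory CategoryTheory.Limits AlgebraicGeometry TopologicalSpace
open Literature.AlgebraicGeometry.Resolution

namespace Summit.ResolutionOfSingularities.ResolutionOfSingularities.Theorems.Pialt.IndeterminacySplit

/-- **Card B, birational transfer into a regular purely inseparable model** (stub
`stub_piRegModel_of_birational` of the line `IndeterminacySplit`). If the proper integral `H` is
birational to the proper integral `X` over `k` (a `k`-isomorphism `e : W ≅ U` of opens, `U`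
non-empty) and `H` has a proper surjective `g : H' → H` with `H'` integral regular, finite and
universally injective over a dense open `U_H`, then `X` has a regular proper purely inseparable
model: `Y := H'` over `k` via `g ≫ fH`, `V := g ⁻¹ᵁ (W ⊓ U_H)`, and `ψ := g ∣_ (W ⊓ U_H)`
followed by the isomorphism of `W ⊓ U_H` onto the open `e(W ⊓ U_H)` of `X` (finite, universally
injective, surjective; compatible over `k`). [folklore] -/
theorem stub_piRegModel_of_birational (k : Type) [Field k] (X : Scheme.{0})
    (f : X ⟶ Spec (.of k)) [IsProper f] [IsIntegral X] (H : Scheme.{0}) (fH : H ⟶ Spec (.of k))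
    [IsProper fH] [IsIntegral H] (U : X.Opens) (W : H.Opens)
    (e : (W : Scheme.{0}) ⟶ (U : Scheme.{0})) [IsIso e] (hU : (U : Set X).Nonempty)
    (hcomm : W.ι ≫ fH = e ≫ U.ι ≫ f)
    (hH : ∃ (H' : Scheme.{0}) (g : H' ⟶ H), IsProper g ∧ IsIntegral H' ∧ Scheme.IsRegular H' ∧
      Function.Surjective g.base ∧ ∃ U : H.Opens, Dense (U : Set H) ∧ IsFinite (g ∣_ U) ∧
        UniversallyInjective (g ∣_ U)) :
    ∃ (Y : Scheme.{0}) (h : Y ⟶ Spec (.of k)), IsProper h ∧ IsIntegral Y ∧ Scheme.IsRegular Y ∧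
      ∃ (U : X.Opens) (V : Y.Opens) (ψ : (V : Scheme.{0}) ⟶ (U : Scheme.{0})),
        (U : Set X).Nonempty ∧ IsFinite ψ ∧ UniversallyInjective ψ ∧
          Function.Surjective ψ.base ∧ V.ι ≫ h = ψ ≫ U.ι ≫ f := by
  obtain ⟨H', g, hg, hint, hreg, hsurj, U_H, hU_H, hfin, hui⟩ := hH
  haveI := hg
  haveI := hfin
  haveI := hui
  -- `W` is non-empty: `e` is an isomorphism onto the non-empty `U`
  have hWne : (W : Set H).Nonempty := by
    obtain ⟨x, hx⟩ := hU
    exact ⟨((inv e).base ⟨x, hx⟩).1, ((inv e).base ⟨x, hx⟩).2⟩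
  -- the non-empty open `W₀ := W ⊓ U_H` of `H`
  set W₀ : H.Opens := W ⊓ U_H with hW₀
  have hW₀ne : (W₀ : Set H).Nonempty := by
    rw [hW₀, Opens.coe_inf]
    exact hU_H.inter_open_nonempty W W.isOpen hWne
  -- the open immersion `j : W₀ → X` and its range `U_X`
  set j : (W₀ : Scheme.{0}) ⟶ X := H.homOfLE (inf_le_left : W₀ ≤ W) ≫ e ≫ U.ι with hj
  haveI : IsOpenImmersion j := by
    rw [hj]
    infer_instance
  have hUXne : (j.opensRange : Set X).Nonempty := by
    obtain ⟨w, hw⟩ := hW₀ne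
    exact ⟨j.base ⟨w, hw⟩, by simp only [Scheme.Hom.coe_opensRange, Set.mem_range_self]⟩
  -- `g ∣_ W₀` is finite, universally injective (as `W₀ ≤ U_H`) and surjective
  have hfin₀ : IsFinite (g ∣_ W₀) := isFinite_morphismRestrict_of_le g inf_le_right
  have hui₀ : UniversallyInjective (g ∣_ W₀) :=
    universallyInjective_morphismRestrict_of_le g inf_le_right
  have hsurj₀ : Surjective (g ∣_ W₀) := by
    haveI : Surjective g := ⟨hsurj⟩
    exact IsZariskiLocalAtTarget.restrict (P := @Surjective) inferInstance W₀
  refine ⟨H', g ≫ fH, inferInstance, hint, hreg, j.opensRange, g ⁻¹ᵁ W₀,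
    (g ∣_ W₀) ≫ j.isoOpensRange.hom, hUXne, inferInstance,
    MorphismProperty.comp_mem _ _ _ hui₀ inferInstance, ?_, ?_⟩
  · haveI : Surjective ((g ∣_ W₀) ≫ j.isoOpensRange.hom) := inferInstance
    exact Scheme.Hom.surjective _
  · rw [Category.assoc, Scheme.Hom.isoOpensRange_hom_ι_assoc, hj, Category.assoc,
      Category.assoc, ← hcomm, Scheme.homOfLE_ι_assoc, ← morphismRestrict_ι_assoc]

end Summit.ResolutionOfSingularities.ResolutionOfSingularities.Theorems.Pialt.IndeterminacySplit

end
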